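import Mathlib.Combinatorics.SimpleGraph.Coloring.Vertex
import Mathlib.Data.Fintype.EquivFin
import Literature.Combinatorics.SimpleGraph.PendantPathRigidificationDiscrete
import HarnessLib

/-!
# Pendant-path rigidification, III: colourability, transport to `Fin M`, the matrix form

Conclusion of `PendantPathRigidification*.lean`.

* `rigidify_colorable_iff` — `rigidify G` is `3`-colourable iff `G` is (pendant paths extend any
  proper colouring: alternate the two colours following the colour of the attachment vertex);
* `IsCRDiscrete.comap_equiv` — CR-discreteness is invariant under isomorphism (transport of
  equitable colourings), so the copy `rigidifyFin G` of `rigidify G` on `Fin (rigidSize n)`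
  (`rigidSize n = |RVert n|`, with `n ≤ rigidSize n ≤ n + n·hairBound² `) is CR-discrete and
  `3`-colourable iff `G` is;
* `rigidMatrix x` — the adjacency matrix of `rigidifyFin (Gr x)` as a function of the matrix
  `x`: every entry is an entry of `x` or a constant (`rigidEntry_inl_inl`,
  `rigidEntry_eq_of_not`), and `Gr (rigidMatrix x) = rigidifyFin (Gr x)` (`grM_rigidMatrix`),
  so `Gr (rigidMatrix x)` is CR-discrete and `3`-colourable iff `Gr x` is.

This is the graph-theoretic half of "a circuit correct on CR-discrete inputs yields, by
hard-wiring the gadget, a circuit correct on all inputs" used to calibrate the rigid-instance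
benchmark of route `PneNP/SymmetryBudget`. Folklore; no printed source.
-/

namespace Literature.Combinatorics.SimpleGraph

open _root_.SimpleGraph Finset PathVert

/-! ## CR-discreteness is an isomorphism invariant -/

section Transport

variable {V W : Type*} [Finite V] [Finite W]

omit [Finite V] [Finite W] in
/-- Equitable colourings transport along an equivalence of vertex types. [folklore] -/
theorem IsEquitable.comap_equiv {G : _root_.SimpleGraph W} (φ : V ≃ W) {κ : Type*} {c : V → κ}
    (hc : IsEquitable (G.comap φ) c) : IsEquitable G (c ∘ φ.symm) := by
  intro u v huv y
  have e : ∀ a : W, {w : W // G.Adj a w ∧ (c ∘ φ.symm) w = y} ≃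
      {w : V // (G.comap φ).Adj (φ.symm a) w ∧ c w = y} := fun a =>
    { toFun := fun w => ⟨φ.symm w.1, by simpa [SimpleGraph.comap_adj] using w.2⟩
      invFun := fun w => ⟨φ w.1, by simpa [SimpleGraph.comap_adj] using w.2⟩
      left_inv := fun w => by simp
      right_inv := fun w => by simp }
  rw [Nat.card_congr (e u), Nat.card_congr (e v)]
  exact hc (φ.symm u) (φ.symm v) (by simpa using huv) y

/-- **CR-discreteness is invariant under isomorphism** (pull-back along an equivalence).
[folklore] -/
theorem IsCRDiscrete.comap_equiv {G : _root_.SimpleGraph W} (hG : IsCRDiscrete G) (φ : V ≃ W) :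
    IsCRDiscrete (G.comap φ) := by
  rw [isCRDiscrete_iff_forall_isEquitable_injective] at hG ⊢
  intro c hc
  have h := hG (φ ∘ c ∘ φ.symm) ((hc.comap_equiv φ).comp_injective φ.injective)
  intro a b hab
  have := @h (φ a) (φ b) (by simp [hab])
  exact φ.injective this

end Transport

/-! ## Colourability -/

variable {n : ℕ}

/-- Rotating a colour of `Fin 3` by one and by a parity bit never returns to it, and the two
parities give different colours. [folklore] -/
theorem fin3_rotations (a : Fin 3) :
    a + 1 + 0 ≠ a ∧ a + 1 + 1 ≠ a + 1 + 0 ∧ a + 1 + 0 ≠ a + 1 + 1 := by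
  revert a; decide

/-- The colour of a vertex of `rigidify G` derived from a colouring `col` of `G`: originals keep
their colour, the path vertex at distance `h` from its original gets `col + 1 + (h mod 2)`.
[folklore] -/
def extendColour (col : Fin n → Fin 3) : RVert n → Fin 3
  | Sum.inl i => col i
  | Sum.inr p => col p.vtx + 1 + (if (p.num - p.pos) % 2 = 0 then 0 else 1)

/-- **`rigidify G` is `3`-colourable iff `G` is.** [folklore] -/
theorem rigidify_colorable_iff (G : _root_.SimpleGraph (Fin n)) :
    (rigidify G).Colorable 3 ↔ G.Colorable 3 := by
  constructor
  · intro h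
    exact h.of_hom ⟨Sum.inl, fun hab => hab⟩
  · rintro ⟨col⟩
    refine ⟨Coloring.mk (extendColour col) fun {a b} hab => ?_⟩
    cases a with
    | inl i =>
      cases b with
      | inl i' => exact col.valid hab
      | inr q =>
        obtain ⟨hv, hq⟩ := (rigidify_adj_inl_inr i q).1 hab
        subst hv
        have h0 : (q.num - q.pos) % 2 = 0 := by rw [hq, Nat.sub_self]
        show col q.vtx ≠ col q.vtx + 1 + (if (q.num - q.pos) % 2 = 0 then 0 else 1)
        rw [if_pos h0]
        exact (fin3_rotations _).1.symm
    | inr p =>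
      cases b with
      | inl i' =>
        obtain ⟨hv, hp⟩ := (rigidify_adj_inr_inl p i').1 hab
        subst hv
        have h0 : (p.num - p.pos) % 2 = 0 := by rw [hp, Nat.sub_self]
        show col p.vtx + 1 + (if (p.num - p.pos) % 2 = 0 then 0 else 1) ≠ col p.vtx
        rw [if_pos h0]
        exact (fin3_rotations _).1
      | inr q =>
        obtain ⟨hv, hnum, hpos⟩ := (rigidify_adj_inr_inr p q).1 hab
        have hq := q.pos_le
        have hp := p.pos_le
        show col p.vtx + 1 + (if (p.num - p.pos) % 2 = 0 then 0 else 1) ≠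
          col q.vtx + 1 + (if (q.num - q.pos) % 2 = 0 then 0 else 1)
        rw [hv]
        by_cases hP : (p.num - p.pos) % 2 = 0
        · rw [if_pos hP, if_neg (by omega)]
          exact (fin3_rotations _).2.2
        · rw [if_neg hP, if_pos (by omega)]
          exact (fin3_rotations _).2.1

/-! ## Transport to `Fin M` -/

/-- The number of vertices of the rigidified graph. [folklore] -/
def rigidSize (n : ℕ) : ℕ := Fintype.card (RVert n)

/-- `n ≤ rigidSize n`. [folklore] -/
theorem le_rigidSize (n : ℕ) : n ≤ rigidSize n := by
  unfold rigidSize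
  rw [Fintype.card_sum, Fintype.card_fin]
  exact Nat.le_add_right _ _

/-- `rigidSize n ≤ n + n · hairBound n · hairBound n` (a polynomial in `n`). [folklore] -/
theorem rigidSize_le (n : ℕ) : rigidSize n ≤ n + n * (hairBound n * hairBound n) := by
  unfold rigidSize
  rw [Fintype.card_sum, Fintype.card_fin]
  have h : Fintype.card (PathVert n) ≤ Fintype.card (Fin n × Fin (hairBound n) × Fin (hairBound n)) :=
    Fintype.card_subtype_le _
  simp only [Fintype.card_prod, Fintype.card_fin] at h
  omega

/-- The enumeration of the vertices of the rigidified graph. [folklore] -/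
noncomputable def rigidEquiv (n : ℕ) : RVert n ≃ Fin (rigidSize n) := Fintype.equivFin (RVert n)

/-- **The rigidified graph on `Fin (rigidSize n)`.** [folklore] -/
noncomputable def rigidifyFin (G : _root_.SimpleGraph (Fin n)) : _root_.SimpleGraph (Fin (rigidSize n)) :=
  (rigidify G).comap (rigidEquiv n).symm

/-- `rigidifyFin G` is CR-discrete. [folklore] -/
theorem isCRDiscrete_rigidifyFin (G : _root_.SimpleGraph (Fin n)) : IsCRDiscrete (rigidifyFin G) :=
  (isCRDiscrete_rigidify G).comap_equiv _

/-- `rigidifyFin G` is `3`-colourable iff `G` is. [folklore] -/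
theorem rigidifyFin_colorable_iff (G : _root_.SimpleGraph (Fin n)) :
    (rigidifyFin G).Colorable 3 ↔ G.Colorable 3 := by
  rw [← rigidify_colorable_iff G]
  have e : rigidifyFin G ≃g rigidify G := SimpleGraph.Iso.comap (rigidEquiv n).symm (rigidify G)
  exact ⟨fun h => h.of_hom e.symm.toHom, fun h => h.of_hom e.toHom⟩

/-! ## The adjacency matrix of `rigidifyFin (Gr x)` as a function of `x` -/

/-- The graph read off an `m × m` Boolean matrix (symmetrised, loops dropped). [folklore] -/
abbrev GrM {m : ℕ} (x : Fin m × Fin m → Bool) : _root_.SimpleGraph (Fin m) :=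
  _root_.SimpleGraph.fromRel fun u v => x (u, v) = true

/-- The constant part of the gadget's adjacency (everything except original–original pairs).
[folklore] -/
def gadgetRel : RVert n → RVert n → Prop := rigidRel (⊥ : _root_.SimpleGraph (Fin n))

/-- `gadgetRel` is decidable. [folklore] -/
instance gadgetRel.decidableRel : DecidableRel (gadgetRel (n := n)) := fun a b => by
  cases a <;> cases b <;> simp only [gadgetRel, rigidRel] <;> infer_instance

/-- One entry of the gadget matrix, on decoded indices: `x(i,i')` on original–original pairs,
the (constant) gadget bit elsewhere. [folklore] -/
def rigidEntry (x : Fin n × Fin n → Bool) : RVert n → RVert n → Bool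
  | Sum.inl i, Sum.inl i' => x (i, i')
  | a, b => decide (gadgetRel a b)

/-- **The matrix of the rigidified graph**: entry `(a, b)` is `rigidEntry x` of the decoded
vertices. [folklore] -/
noncomputable def rigidMatrix (x : Fin n × Fin n → Bool) : Fin (rigidSize n) × Fin (rigidSize n) → Bool :=
  fun q => rigidEntry x ((rigidEquiv n).symm q.1) ((rigidEquiv n).symm q.2)

/-- On original–original pairs the entry is the corresponding entry of `x`. [folklore] -/
theorem rigidEntry_inl_inl (x : Fin n × Fin n → Bool) (i i' : Fin n) :
    rigidEntry x (Sum.inl i) (Sum.inl i') = x (i, i') := rfl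

/-- Elsewhere the entry does not depend on `x`. [folklore] -/
theorem rigidEntry_eq_of_not (x x' : Fin n × Fin n → Bool) (a b : RVert n)
    (h : ¬ (∃ i i', a = Sum.inl i ∧ b = Sum.inl i')) : rigidEntry x a b = rigidEntry x' a b := by
  cases a with
  | inl i =>
    cases b with
    | inl i' => exact absurd ⟨i, i', rfl, rfl⟩ h
    | inr q => rfl
  | inr p => cases b <;> rfl

/-- Off the original–original pairs, `rigidEntry` is the gadget bit, which is the adjacency of
`rigidify G` for every `G`. [folklore] -/
theorem rigidEntry_iff_of_not {G : _root_.SimpleGraph (Fin n)} (x : Fin n × Fin n → Bool) (a b : RVert n)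
    (h : ¬ (∃ i i', a = Sum.inl i ∧ b = Sum.inl i')) :
    rigidEntry x a b = true ↔ (rigidify G).Adj a b := by
  cases a with
  | inl i =>
    cases b with
    | inl i' => exact absurd ⟨i, i', rfl, rfl⟩ h
    | inr q => simp [rigidEntry, gadgetRel, rigidRel, rigidify]
  | inr p =>
    cases b with
    | inl i' => simp [rigidEntry, gadgetRel, rigidRel, rigidify]
    | inr q => simp [rigidEntry, gadgetRel, rigidRel, rigidify]

/-- **The matrix decodes to the rigidified graph**: `Gr (rigidMatrix x) = rigidifyFin (Gr x)`.
[folklore] -/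
theorem grM_rigidMatrix (x : Fin n × Fin n → Bool) : GrM (rigidMatrix x) = rigidifyFin (GrM x) := by
  ext a b
  rw [SimpleGraph.fromRel_adj]
  show a ≠ b ∧ (rigidMatrix x (a, b) = true ∨ rigidMatrix x (b, a) = true) ↔
    (rigidify (GrM x)).Adj ((rigidEquiv n).symm a) ((rigidEquiv n).symm b)
  have hab : a ≠ b ↔ (rigidEquiv n).symm a ≠ (rigidEquiv n).symm b :=
    (rigidEquiv n).symm.injective.ne_iff.symm
  rw [hab]
  unfold rigidMatrix
  generalize (rigidEquiv n).symm a = u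
  generalize (rigidEquiv n).symm b = v
  by_cases h : ∃ i i', u = Sum.inl i ∧ v = Sum.inl i'
  · obtain ⟨i, i', rfl, rfl⟩ := h
    simp only [rigidEntry_inl_inl, rigidify_adj_inl_inl, SimpleGraph.fromRel_adj, ne_eq, Sum.inl.injEq]
  · have h' : ¬ ∃ i i', v = Sum.inl i ∧ u = Sum.inl i' := fun ⟨i, i', hv, hu⟩ => h ⟨i', i, hu, hv⟩
    rw [rigidEntry_iff_of_not (G := GrM x) x u v h, rigidEntry_iff_of_not (G := GrM x) x v u h']
    constructor
    · rintro ⟨-, h1 | h1⟩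
      · exact h1
      · exact h1.symm
    · intro h1
      exact ⟨h1.ne, Or.inl h1⟩

/-- **Hence on these matrices the rigidified graph is read**: CR-discrete, and `3`-colourable iff
`Gr x` is. [folklore] -/
theorem isCRDiscrete_grM_rigidMatrix (x : Fin n × Fin n → Bool) : IsCRDiscrete (GrM (rigidMatrix x)) := by
  rw [grM_rigidMatrix]; exact isCRDiscrete_rigidifyFin _

/-- `Gr (rigidMatrix x)` is `3`-colourable iff `Gr x` is. [folklore] -/
theorem grM_rigidMatrix_colorable_iff (x : Fin n × Fin n → Bool) :
    (GrM (rigidMatrix x)).Colorable 3 ↔ (GrM x).Colorable 3 := by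
  rw [grM_rigidMatrix]; exact rigidifyFin_colorable_iff _

end Literature.Combinatorics.SimpleGraph
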